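import Summits.HodgeConjecture.CorCM.GaloisThirtyTwoTimesOddPrimeStructure
import Summits.HodgeConjecture.CorCM.GaloisNonNormalPrimeOrderQuotientOrbits
import HarnessLib

/-!
# `32 ∣ [K:ℚ]`: the Sylow `p`-subgroups of the Galois group of a GOOD Galois CM field are NORMAL and of order `≤ p`, for EVERY odd
# prime `p` — no size hypothesis

COR-CM (cell `pub-hodgecm2`), binder seat b04 (gen 39), count-neutral own lane «Galois-CM-type classification».  KERNEL ONLY:
theorems; no definition, no named fact, no `sorry`.  `HC_CM` is neither used nor claimed.

Gen 38 (`CorCM/GaloisNormalSylow`): GOOD + `[K:ℚ] = 2·pᵃ·m` (`p ∤ m`) with gen 33's size condition `16 ≤ m`, `8p ≤ 2^(m/4)` (or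
`p ≥ 31` with nothing) ⟹ the Sylow `p`-subgroups of `Gal(K/ℚ)` are normal; `CorCM/GaloisLargeDegreeStructure` observed that
`64 ∣ [K:ℚ]` discharges the size condition.  With `32 ∣ [K:ℚ]` only, the size condition fails exactly when `m = 16`, i.e. in the CM
quotient `Gal(K/ℚ)/O_p(Gal)` of order `32·p` carrying a non-normal subgroup of order `p` (gen 38's maximal-normal-`p`-subgroup
dichotomy `NormalSylow.sylow_normal_or_exists_nonnormal_mod`).  That quotient is now handled for every odd `p`:
`p ∈ {3, 5, 7}` by the refined count of gen 39 modulo `N` (`exists_conj_pow_mod_of_forall_isNondegenerate'`,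
`CorCM/GaloisNonNormalPrimeOrderQuotientOrbits`; thresholds `78, 150, 210 ≤ 96, 160, 224`), `p ∈ {11, …, 29}` by Sylow counting INSIDE
the quotient (its Sylow `p`-subgroup has order `p` and index `32`, and no divisor `d ≠ 1` of `32` is `≡ 1 (mod p)`), `p ≥ 31` by gen 38.
All larger quotients (`[Gal:N] = 2p·16k`, `k ≥ 2`) satisfy gen 33's size condition (`8p ≤ 240 < 2⁸ ≤ 2^(4k)`).

* **`sylow_normal_of_forall_isNondegenerate_of_thirtytwo_dvd`** — `32 ∣ [K:ℚ]`, `p` an odd prime, `K` GOOD ⟹ every Sylow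
  `p`-subgroup of `Gal(K/ℚ)` is normal.
* **`sylow_normal_and_le_one_of_thirtytwo_dvd`** — `[K:ℚ] = 2·pᵃ·m`, `p ∤ m`, `16 ∣ m`, `K` GOOD ⟹ Sylow `p` normal and `a ≤ 1`
  (gen 38's `card_sylow_le_of_normal`: a normal Sylow `p`-subgroup of index `≥ 14` of a GOOD field has order `≤ p`).
* `exists_simple_degenerate_of_sylow_not_normal_of_thirtytwo_dvd`, `exists_simple_degenerate_of_sq_dvd_of_thirtytwo_dvd` — BAD
  corollaries: `32 ∣ [K:ℚ]` and a non-normal Sylow `p`-subgroup (`p` odd), or `32p² ∣ [K:ℚ]`, yields a simple degenerate CM abelian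
  variety of dimension `[K:ℚ]/2` with an exceptional Hodge class on some power.
Consumer: `CorCM/GaloisThirtyTwoDividesStructure` (gen 39: the full structure theorem from `32 ∣ [K:ℚ]`).

## References

* [Rotman1995] J. J. Rotman, *An Introduction to the Theory of Groups*, 4th ed., GTM 148, Thm. 4.2, Thm. 4.12, Ex. 4.11.
* [Shimura1998] G. Shimura, *Abelian Varieties with Complex Multiplication and Modular Functions*, §6.2 Thm. 3, §8.2 Prop. 26, §32.10.
* [Gordon1999HodgeAVSurvey] B. B. Gordon, *A survey of the Hodge conjecture for abelian varieties*, Thm. 6.4, §9.3.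
* [Dodson1984] B. Dodson, *The structure of Galois groups of CM-fields*, Trans. AMS 283 (1984), §3.1.1, §5.
-/

noncomputable section

open CategoryTheory CategoryTheory.Limits NumberField
open scoped BigOperators

namespace Summit.HodgeConjecture.CorCM.GaloisModels

open Literature.NumberTheory.ComplexMultiplication
open Literature.AlgebraicGeometry.Motives (AbelianVariety CMType)
open Literature.AlgebraicGeometry.HodgeTheory
open Literature.AlgebraicGeometry.ComplexMultiplication (IsCMTypeRealisation)
open Literature.AlgebraicGeometry.Pohlmann1968
open Literature.Barriers.HodgeConjecture (divisorClassesSpan)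
open Summit.HodgeConjecture.CorCM.GaloisRank
open Summit.HodgeConjecture.CorCM.GaloisModels.NormalSylow

variable {K : Type} [Field K] [NumberField K] [IsCMField K] [IsGalois ℚ K]

/-! ## §1 `32 ∣ [K:ℚ]`: the Sylow `p`-subgroups are normal -/

/-- **`32 ∣ [K:ℚ]`, `p` ANY ODD PRIME, `K` GOOD ⟹ every Sylow `p`-subgroup of `Gal(K/ℚ)` is NORMAL** (no size hypothesis).
[cite: Rotman1995, Thm. 4.2, Thm. 4.12 and Ex. 4.11] [cite: Shimura1998, §8.2 Prop. 26 and §32.10] [cite: Dodson1984, §5] -/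
theorem sylow_normal_of_forall_isNondegenerate_of_thirtytwo_dvd (p : ℕ) [hp : Fact p.Prime] (hp2 : p ≠ 2)
    (h32 : 32 ∣ Module.finrank ℚ K)
    (hgood : ∀ (Φ : CMType K) (φ : K →+* ℂ), IsPrimitive (ℂ ≃+* ℂ) Φ.1 φ → IsNondegenerate Φ)
    (P : Sylow p (K ≃ₐ[ℚ] K)) : (P : Subgroup (K ≃ₐ[ℚ] K)).Normal := by
  classical
  have hpp := hp.out
  by_cases h31 : 31 ≤ p
  · exact sylow_normal_of_forall_isNondegenerate_of_ge p h31 hgood P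
  rcases sylow_normal_or_exists_nonnormal_mod (K ≃ₐ[ℚ] K) p with hall | ⟨N, hN, hNP, hmax, hdvd, x, g, hxN, hxp, hg⟩
  · exact hall P
  exfalso
  haveI := hN
  have hcN := complexConj_not_mem_of_isPGroup hp2 N hNP
  -- the Sylow `p`-subgroups of `Gal/N` are not all normal
  have hQ : ∃ Q : Sylow p ((K ≃ₐ[ℚ] K) ⧸ N), ¬ (Q : Subgroup ((K ≃ₐ[ℚ] K) ⧸ N)).Normal := by
    by_contra h
    push Not at h
    exact not_dvd_index_of_maximal_of_sylow_quotient_normal N hNP hmax h hdvd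
  -- complex conjugation modulo `N`: a central involution of `Gal/N`
  set c := (IsCMField.complexConj K).restrictScalars ℚ with hc
  have hcomm := model_complexConj_comm (K := K) (MulEquiv.refl _) rfl
  have hcc := model_complexConj_mul_self (K := K) (MulEquiv.refl _) rfl
  rw [MulEquiv.refl_apply] at hcc
  have hcz' : ∀ q : (K ≃ₐ[ℚ] K) ⧸ N, (QuotientGroup.mk c : (K ≃ₐ[ℚ] K) ⧸ N) * q = q * QuotientGroup.mk c := by
    intro q
    obtain ⟨y, rfl⟩ := QuotientGroup.mk_surjective q
    rw [← QuotientGroup.mk_mul, ← QuotientGroup.mk_mul]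
    congr 1
    simpa using hcomm y
  have hcc' : (QuotientGroup.mk c : (K ≃ₐ[ℚ] K) ⧸ N) * QuotientGroup.mk c = 1 := by
    rw [← QuotientGroup.mk_mul, hcc, QuotientGroup.mk_one]
  have hc1' : (QuotientGroup.mk c : (K ≃ₐ[ℚ] K) ⧸ N) ≠ 1 := fun h => hcN ((QuotientGroup.eq_one_iff c).1 h)
  -- `2p ∣ [Gal:N]`, `32 ∣ [Gal:N]`, hence `[Gal:N] = 2p·16k`
  obtain ⟨Q, hQ⟩ := hQ
  have hbig : 2 * p * (p + 1) ≤ N.index := card_ge_of_sylow_not_normal hp2 hcz' hcc' hc1' Q hQ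
  have h2 : 2 ∣ N.index := by
    have hord : orderOf (QuotientGroup.mk c : (K ≃ₐ[ℚ] K) ⧸ N) = 2 := orderOf_eq_prime (by rw [pow_two, hcc']) hc1'
    rw [← hord]
    exact orderOf_dvd_natCard _
  obtain ⟨n, hn⟩ : 2 * p ∣ N.index :=
    Nat.Coprime.mul_dvd_of_dvd_of_dvd ((Nat.coprime_primes Nat.prime_two hpp).2 (Ne.symm hp2)) h2 hdvd
  obtain ⟨j, hj⟩ := IsPGroup.iff_card.1 hNP
  have h32idx : 2 ^ 5 ∣ N.index := by
    have h1 : 2 ^ 5 ∣ N.index * p ^ j := by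
      rw [← hj, Subgroup.index_mul_card, IsGalois.card_aut_eq_finrank]; exact h32
    exact (Nat.Coprime.pow 5 j ((Nat.coprime_primes Nat.prime_two hpp).2 (Ne.symm hp2))).dvd_of_dvd_mul_right h1
  have h16n : 16 ∣ n := by
    have h1 : 2 ^ 4 ∣ n * p := by
      have h' : 2 * 2 ^ 4 ∣ 2 * (n * p) := by
        have : 2 * (n * p) = N.index := by rw [hn]; ring
        rw [this]; exact h32idx
      exact Nat.dvd_of_mul_dvd_mul_left two_pos h'
    exact (Nat.Coprime.pow 4 1 ((Nat.coprime_primes Nat.prime_two hpp).2 (Ne.symm hp2))).dvd_of_dvd_mul_right (by rw [pow_one]; exact h1)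
  obtain ⟨k, rfl⟩ := h16n
  have hk1 : 1 ≤ k := by
    by_contra h0
    have : k = 0 := by omega
    subst this
    rw [mul_zero, mul_zero] at hn
    exact absurd hn (Subgroup.index_ne_zero_of_finite (H := N))
  by_cases hk : k = 1
  · subst hk
    rw [mul_one] at hn
    by_cases hsmall : p = 3 ∨ p = 5 ∨ p = 7
    · -- the refined count modulo `N` at `n = 16`
      have hcount : ∀ m, 2 ≤ m → m ∣ 16 →
          (2 * p * 16 - 1 - m * (p - 1)) * 2 ^ (16 / 2) + m * (p - 1) * 2 ^ ((16 + (p - 1) * (16 / m)) / p) < 2 ^ 16 := by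
        rcases hsmall with rfl | rfl | rfl
        · exact SkewSectionPrime.count'_three 16 (by norm_num)
        · exact SkewSectionPrime.count'_five 16 (by norm_num)
        · exact SkewSectionPrime.count'_seven 16 (by norm_num)
      obtain ⟨k', -, hk'⟩ := exists_conj_pow_mod_of_forall_isNondegenerate' N hcN p 16 hn hcount hgood x hxN hxp g
      exact hg k' hk'
    by_cases hmid : p = 11 ∨ p = 13 ∨ p = 17 ∨ p = 19 ∨ p = 23 ∨ p = 29
    · -- Sylow counting inside `Gal/N` (order `32p`): the Sylow `p`-subgroup `Q` has index `32`, so it is normal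
      apply hQ
      obtain ⟨kQ, hkQ⟩ := Q.isPGroup'.exists_card_eq
      have hcardG : Nat.card ((K ≃ₐ[ℚ] K) ⧸ N) = p ^ 1 * 2 ^ 5 := by rw [← Subgroup.index_eq_card, hn]; ring
      have h : p ^ kQ * (Q : Subgroup ((K ≃ₐ[ℚ] K) ⧸ N)).index = p ^ 1 * 2 ^ 5 := by
        rw [← hkQ, Subgroup.card_mul_index, hcardG]
      have hpr : ¬ p ∣ 2 ^ 5 := fun h' => hp2 ((Nat.prime_dvd_prime_iff_eq hpp Nat.prime_two).1 (hpp.dvd_of_dvd_pow h'))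
      obtain ⟨-, hidxQ⟩ := pow_eq_of_mul_eq_of_not_dvd hpp h Q.not_dvd_index hpr
      exact sylow_normal_of_forall_dvd_index Q fun d hd hmod =>
        eq_one_of_dvd_thirtytwo_of_modEq hmid (by rw [← hidxQ]; exact hd) hmod
    · exact h31 (thirtyone_le_of_prime hpp hp2 hsmall hmid)
  · -- `k ≥ 2`: gen 33's size condition holds (`8p ≤ 240 < 256 ≤ 2^(4k)`)
    have hk2 : 2 ≤ k := by omega
    have hn16 : 16 ≤ 16 * k := by omega
    have h8 : 8 * p ≤ 2 ^ (16 * k / 4) := by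
      calc 8 * p ≤ 2 ^ 8 := by norm_num; omega
        _ ≤ 2 ^ (16 * k / 4) := Nat.pow_le_pow_right two_pos (by omega)
    obtain ⟨k', -, hk'⟩ := exists_conj_pow_mod_of_forall_isNondegenerate N hcN p (16 * k) hn hn16 h8 hgood x hxN hxp g
    exact hg k' hk'

/-- **`[K:ℚ] = 2·pᵃ·m`, `p` odd, `p ∤ m`, `16 ∣ m`, `K` GOOD ⟹ the Sylow `p`-subgroups of `Gal(K/ℚ)` are normal and `a ≤ 1`** (gen 38's
`sylow_normal_and_le_one` without the size condition). [cite: Rotman1995, Thm. 4.12] [cite: Shimura1998, §8.2 Prop. 26 and §32.10]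
[cite: Dodson1984, §3.1.1 and §5] -/
theorem sylow_normal_and_le_one_of_thirtytwo_dvd {p a m : ℕ} [hp : Fact p.Prime] (hp2 : p ≠ 2)
    (hdeg : Module.finrank ℚ K = 2 * p ^ a * m) (hpm : ¬ p ∣ m) (h16 : 16 ∣ m)
    (hgood : ∀ (Φ : CMType K) (φ : K →+* ℂ), IsPrimitive (ℂ ≃+* ℂ) Φ.1 φ → IsNondegenerate Φ) :
    (∀ P : Sylow p (K ≃ₐ[ℚ] K), (P : Subgroup (K ≃ₐ[ℚ] K)).Normal) ∧ a ≤ 1 := by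
  classical
  have hpp := hp.out
  have h32 : 32 ∣ Module.finrank ℚ K := by
    obtain ⟨m', rfl⟩ := h16
    rw [hdeg]
    exact ⟨p ^ a * m', by ring⟩
  have hnormal : ∀ P : Sylow p (K ≃ₐ[ℚ] K), (P : Subgroup (K ≃ₐ[ℚ] K)).Normal :=
    fun P => sylow_normal_of_forall_isNondegenerate_of_thirtytwo_dvd p hp2 h32 hgood P
  refine ⟨hnormal, ?_⟩
  obtain ⟨P⟩ := (inferInstance : Nonempty (Sylow p (K ≃ₐ[ℚ] K)))
  haveI := hnormal P
  have hm0 : 0 < m := by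
    by_contra h
    have : m = 0 := by omega
    subst this
    rw [mul_zero] at hdeg
    exact absurd hdeg (Nat.pos_iff_ne_zero.1 Module.finrank_pos)
  have hdeg' : Module.finrank ℚ K = p ^ a * (2 * m) := by rw [hdeg]; ring
  have hpr : ¬ p ∣ 2 * m := fun h => by
    rcases (Nat.Prime.dvd_mul hpp).1 h with h | h
    · exact hp2 ((Nat.prime_dvd_prime_iff_eq hpp Nat.prime_two).1 h)
    · exact hpm h
  obtain ⟨hcardP, hidxP⟩ := card_sylow_eq_of_finrank hdeg' hpr P
  have hidx : 14 ≤ (P : Subgroup (K ≃ₐ[ℚ] K)).index := by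
    rw [hidxP]; obtain ⟨m', rfl⟩ := h16; omega
  have h := card_sylow_le_of_normal hp2 P hidx hgood
  rw [hcardP] at h
  exact le_one_of_pow_eq hpp h

/-! ## §2 BAD corollaries -/

/-- **`32 ∣ [K:ℚ]` and a NON-NORMAL Sylow `p`-subgroup of `Gal(K/ℚ)` (`p` odd) ⟹ BAD**: `K` carries a SIMPLE DEGENERATE abelian variety
of dimension `[K:ℚ]/2` with a rational `(q,q)` class outside the divisor ring on some power. [cite: Shimura1998, §6.2 Thm. 3 and §8.2 Prop. 26]
[cite: Gordon1999HodgeAVSurvey, Thm. 6.4 and §9.3] [cite: Rotman1995, Thm. 4.12] -/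
theorem exists_simple_degenerate_of_sylow_not_normal_of_thirtytwo_dvd {p : ℕ} (hp : p.Prime) (hp2 : p ≠ 2)
    (h32 : 32 ∣ Module.finrank ℚ K) (Q : @Sylow p (K ≃ₐ[ℚ] K) _) (hQ : ¬ (Q : Subgroup (K ≃ₐ[ℚ] K)).Normal) :
    ∃ (Φ : CMType K) (φ : K →+* ℂ) (X : AbelianVariety ℂ) (ι : 𝓞 K →+* End X)
      (ϑ : K →+* Module.End ℂ (complexBetti X.X 1)),
      IsPrimitive (ℂ ≃+* ℂ) Φ.1 φ ∧ ¬ IsNondegenerate Φ ∧ IsCMTypeRealisation Φ X ι ϑ ∧ X.IsSimple ∧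
      X.dim = Module.finrank ℚ K / 2 ∧
      ∃ n p : ℕ, ∃ x : complexBetti (⨁ fun _ : Fin n => X).X (2 * p), IsRationalClass x ∧
        IsOfHodgeType (⨁ fun _ : Fin n => X).dim (⨁ fun _ : Fin n => X).X (2 * p) p p x ∧
        x ∉ divisorClassesSpan (⨁ fun _ : Fin n => X).X (⨁ fun _ : Fin n => X).dim p :=
  haveI : Fact p.Prime := ⟨hp⟩
  exists_simple_degenerate_of_not_forall_isNondegenerate fun hgood =>
    hQ (sylow_normal_of_forall_isNondegenerate_of_thirtytwo_dvd p hp2 h32 hgood Q)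

/-- **`[K:ℚ] = 2·pᵃ·m` with `p` odd, `p ∤ m`, `16 ∣ m` and `a ≥ 2` (i.e. `32p² ∣ [K:ℚ]` at the full `p`-part) ⟹ BAD.**
[cite: Shimura1998, §6.2 Thm. 3 and §8.2 Prop. 26] [cite: Gordon1999HodgeAVSurvey, Thm. 6.4 and §9.3] [cite: Dodson1984, §3.1.1 and §5] -/
theorem exists_simple_degenerate_of_sq_dvd_of_thirtytwo_dvd {p a m : ℕ} (hp : p.Prime) (hp2 : p ≠ 2)
    (hdeg : Module.finrank ℚ K = 2 * p ^ a * m) (hpm : ¬ p ∣ m) (h16 : 16 ∣ m) (ha : 2 ≤ a) :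
    ∃ (Φ : CMType K) (φ : K →+* ℂ) (X : AbelianVariety ℂ) (ι : 𝓞 K →+* End X)
      (ϑ : K →+* Module.End ℂ (complexBetti X.X 1)),
      IsPrimitive (ℂ ≃+* ℂ) Φ.1 φ ∧ ¬ IsNondegenerate Φ ∧ IsCMTypeRealisation Φ X ι ϑ ∧ X.IsSimple ∧
      X.dim = Module.finrank ℚ K / 2 ∧
      ∃ n p : ℕ, ∃ x : complexBetti (⨁ fun _ : Fin n => X).X (2 * p), IsRationalClass x ∧
        IsOfHodgeType (⨁ fun _ : Fin n => X).dim (⨁ fun _ : Fin n => X).X (2 * p) p p x ∧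
        x ∉ divisorClassesSpan (⨁ fun _ : Fin n => X).X (⨁ fun _ : Fin n => X).dim p :=
  haveI : Fact p.Prime := ⟨hp⟩
  exists_simple_degenerate_of_not_forall_isNondegenerate fun hgood => by
    have h := (sylow_normal_and_le_one_of_thirtytwo_dvd hp2 hdeg hpm h16 hgood).2
    omega

end Summit.HodgeConjecture.CorCM.GaloisModels

end
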